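import Mathlib
import HarnessLib.Audit
import Summits.PneNP.PneNP.Theorems.PstarCircuitJoins
import Summits.PneNP.PneNP.Theorems.PstarMemberKillCores

/-!
# The member kills on a cycle core: the census check-list (ROUND-24, O1; memo g28 §78)

FRONTIER range-avoidance ladder, rung F-N3, ROUND 24 (cell `pnp-ideate`, prover-2 memo `g28/O1-JOINS-g28.md` §78; census node
`PstarLocalGateBudgetAssembly.LocalMenuCriterionBoundGateBudget`; restricted-model proof complexity — nothing here bears on `P` versus `NP`).

`PstarMemberKillCores.false_of_dirty_member_joins` / `false_of_shared_member_joins` kill a candidate certificate `(K; Γ₁, Γ₂)` at a member `e`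
under join-enumeration hypotheses; `PstarCircuitJoins.forall_join_of_four` lists the joins of a CIRCUIT core (only even subfamilies `∅`, `K`) as
`(∅,0), (K,0), (P,1), (K ∖ P,1)` for one join `P` with the reader — the arc of `e` and the other arc.  This file performs the instantiation once, in
the form the census evaluates.  Standing hypotheses: typed pure instance, `K` an even circuit (a cycle core), `K ∩ G₁ = ∅`, the reader's linear part
`C₁` consists of XOR-type variables (true for chord path sums) — so AND variables are automatically off `C₁` and off the XOR slots (`through_not_mem`,
`through_ne_xor`) —, PRIVACY on `K ∪ G₁`, simple overlaps among the monomials of `Γ₂`.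

* `not_even_singleton` — a single output is never an even family (its XOR pair is a pair);
* **`false_of_dirty_member_cycle`** — DIRTY member `e ∈ P` (AND pair `p, p'` private, no `Γ₂`-gate `{p, p'}`).  CHECK-LIST: (idle) if the arc of `e`
  is `{e}` alone and there are no folds, its value is `0`; (partners) every `Γ₂`-gate partner `u` of `p` or `p'` is EITHER pinned on the other arc —
  `K ∖ P` and all folds pass through `u` and `v(K ∖ P, 1) = 1` — OR has a thaw pattern `Z ∋ v` of AND-type variables containing its `K ∪ G₁`-partners
  such that each of `K`, `P ∪ G₁`, `(K ∖ P) ∪ G₁` has a LIVE member or value `0`.  Then `¬ SatPair K ∧ SatPair (K ∖ e)` is contradictory; corollaries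
  **`not_terminal_of_dirty_member_cycle`**, **`not_terminalNC_of_dirty_member_cycle`**.  (The candidates `(K,0)` and `(K ∖ P,1)` of the idle
  pattern are discharged inside: `K = {e}` is not even, and `K ∖ P = ∅` forces the empty reader, whose target is then `0` by (M0).)
* **`exists_gate_of_dirty_member_cycle`** — the POSITIVE SHAPE (memo g27 §75 (i)): a certificate needs a `Γ₂`-gate linking the private pair of `e`
  to a variable `u` not pinned on the other arc whose every admissible thaw pattern swallows, with value `1`, the core or one of the two
  arcs-with-folds — on a two-block arc: `u` lies in the OTHER block of `e`'s arc (the cross monomial `v(B₁)·v(B₂)`).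
* **`no_reader_of_dirty_member_cycle`** — the `Γ₂`-FREE form: if EVERY variable `u ∉ {p, p'}` is pinned on the other arc or leaves `K`, `P ∪ G₁`,
  `(K ∖ P) ∪ G₁` each with a member that is LIVE for `(u, v)` (off `v`, no AND variable a partner of `u`) or of value `0`, then no second reader at
  all certifies through `e` — «the arc of `e` certifies nothing», for every `Γ₂` and every `k`.
* The shared-literal member (`e = (σ, p)` with sibling `o = (σ, q)`) is the companion file `PstarCycleCoreKillsShared`.

READING («three-block arcs certify nothing», p3 memo r24 §14.63, all `k`): the thaw pattern of `u` kills `e` and `u`'s block only, so the three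
liveness clauses hold as soon as the arc `P ∪ G₁` of `e` carries two further blocks and the other arc is not swallowed by `u`'s block — and when it
is, with value `1`, `u` is pinned there (first branch).  No assignment is quantified over: the kill is decided by the incidence data of
`(K, P, G₁, G₂)` and the values `y, b₁`.
-/

set_option linter.dupNamespace false -- `Summit.PneNP.PneNP.…`: summit = sub-problem name (D-0017 single-conjunct layout)

open Finset Literature.Computability.Complexity
open Summit.PneNP.PneNP.Theorems.PstarFibrePolys (bit bit_injective)
open Summit.PneNP.PneNP.Theorems.PstarTyped (Typed)
open Summit.PneNP.PneNP.Theorems.PstarSALevel (varSet)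
open Summit.PneNP.PneNP.Theorems.PstarGapOneAll (gval)
open Summit.PneNP.PneNP.Theorems.PstarGConstraint (bit_gval)
open Summit.PneNP.PneNP.Theorems.PstarCoreBoundTargets (Terminal)
open Summit.PneNP.PneNP.Theorems.PstarUnion (SatPair)
open Summit.PneNP.PneNP.Theorems.PstarUnionCovers (TerminalNC)
open Summit.PneNP.PneNP.Theorems.PstarXorElimination (pdeg)
open Summit.PneNP.PneNP.Theorems.PstarChordBridgeTools (xpdeg)
open Summit.PneNP.PneNP.Theorems.PstarLiteralPinning (Through InSlice IsJoin joinValue)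
open Summit.PneNP.PneNP.Theorems.PstarDeadPatterns (Dead)
open Summit.PneNP.PneNP.Theorems.PstarSharedMemberSquare (Setup)
open Summit.PneNP.PneNP.Theorems.PstarCircuitJoins (xpdeg_empty isJoin_true_iff isJoin_sdiff forall_join_of_four joinValue_empty)
open Summit.PneNP.PneNP.Theorems.PstarMemberKillCores (false_of_dirty_member_joins false_of_shared_member_joins)

namespace Summit.PneNP.PneNP.Theorems.PstarCycleCoreKills

variable {n m : ℕ} {I : LocalMap 4 n m} {y : Fin m → Bool} {K : Finset (Fin m)} {w₁ w₂ : Finset (Fin n) × Finset (Fin m) × Bool}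

/-! ## Small facts -/

/-- Every slot variable of an output lies in its variable set. -/
private theorem vars_mem_varSet (I : LocalMap 4 n m) (j : Fin m) (s : Fin 4) : I.vars j s ∈ varSet I j := by
  unfold PstarSALevel.varSet; exact mem_image_of_mem _ (mem_univ s)

/-- **AND variables are never XOR variables** (typed instance). -/
theorem through_ne_xor (hT : Typed I) {u : Fin n} {g : Fin m} (hu : Through I u g) (j : Fin m) : I.vars j 0 ≠ u ∧ I.vars j 1 ≠ u := by
  rcases hu with h | h
  · exact ⟨fun e => hT j g 0 2 (by decide) (by decide) (e.trans h.symm), fun e => hT j g 1 2 (by decide) (by decide) (e.trans h.symm)⟩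
  · exact ⟨fun e => hT j g 0 3 (by decide) (by decide) (e.trans h.symm), fun e => hT j g 1 3 (by decide) (by decide) (e.trans h.symm)⟩

/-- **AND variables are off a linear part made of XOR-type variables** (typed instance; e.g. a chord path sum). -/
theorem through_not_mem (hT : Typed I) {C : Finset (Fin n)} (hCX : ∀ v ∈ C, ∃ j : Fin m, ∃ s : Fin 4, s.val < 2 ∧ I.vars j s = v)
    {u : Fin n} {g : Fin m} (hu : Through I u g) : u ∉ C := by
  intro huC
  obtain ⟨j, s, hs, hjs⟩ := hCX u huC
  rcases hu with h | h
  · exact hT j g s 2 hs (by decide) (hjs.trans h.symm)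
  · exact hT j g s 3 hs (by decide) (hjs.trans h.symm)

/-- **A single output is not an even family**: its two XOR variables are distinct (pure instance). -/
theorem not_even_singleton (hI : I.IsPure xorAndPred) (e : Fin m) : ¬ ∀ w, Even (xpdeg I ({e} : Finset (Fin m)) w) := by
  intro h
  have h10 : ¬ I.vars e 1 = I.vars e 0 := fun h' => absurd (hI.2 e h') (by decide)
  have := h (I.vars e 0)
  simp only [xpdeg, pdeg, filter_singleton, h10, if_true, if_false, card_singleton, card_empty, add_zero] at this
  exact Nat.not_even_one this

/-- A join `(∅, 1)` forces the reader's linear part to be empty. -/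
theorem linear_eq_empty_of_isJoin_empty {C : Finset (Fin n)} (hJ : IsJoin I C (∅ : Finset (Fin m)) true) : C = ∅ := by
  refine eq_empty_of_forall_notMem fun w hw => ?_
  have := (isJoin_true_iff I C ∅).1 hJ w
  rw [xpdeg_empty, if_pos hw, zero_add] at this
  exact Nat.not_even_one this

/-- The empty reader `(∅, ∅, b₁)` is satisfiable only with `b₁ = 0`. -/
theorem target_false_of_empty_reader {C : Finset (Fin n)} {G : Finset (Fin m)} {b : Bool} (hC : C = ∅) (hG : G = ∅) {q : Fin n → Bool}
    (hq : gval I C G q = b) : b = false := by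
  subst hC hG
  rw [← hq]
  apply bit_injective
  rw [bit_gval]
  simp [bit]

variable {P : Finset (Fin m)}

/-! ## The dirty member on a cycle core -/

section Dirty

variable {e : Fin m} {p p' : Fin n}

/-- **THE DIRTY-MEMBER CHECK-LIST ON A CYCLE CORE.**  See the module docstring; conclusion: (T3) together with (M0) at `e` is contradictory. -/
theorem false_of_dirty_member_cycle (hI : I.IsPure xorAndPred) (hT : Typed I) (hKG : Disjoint K w₁.2.1)
    (hKev : ∀ w, Even (xpdeg I K w)) (hmin : ∀ D ⊆ K, (∀ w, Even (xpdeg I D w)) → D = ∅ ∨ D = K)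
    (hP : P ⊆ K) (hPJ : IsJoin I w₁.1 P true) (heP : e ∈ P)
    (hslots : I.vars e 2 = p ∧ I.vars e 3 = p') (hpe : I.vars e 0 ≠ p ∧ I.vars e 1 ≠ p ∧ I.vars e 0 ≠ p' ∧ I.vars e 1 ≠ p')
    (hpK : ∀ j ∈ K, j ≠ e → p ∉ varSet I j ∧ p' ∉ varSet I j)
    (hpG₁ : ∀ g ∈ w₁.2.1, (I.vars g 2 ≠ p ∧ I.vars g 3 ≠ p) ∧ (I.vars g 2 ≠ p' ∧ I.vars g 3 ≠ p'))
    (hpp' : ∀ g ∈ w₂.2.1, ¬ ((I.vars g 2 = p ∧ I.vars g 3 = p') ∨ (I.vars g 2 = p' ∧ I.vars g 3 = p)))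
    (hSG : ∀ g ∈ w₂.2.1, ∀ g' ∈ w₂.2.1, g' ≠ g → ¬ ((I.vars g' 2 = I.vars g 2 ∧ I.vars g' 3 = I.vars g 3) ∨
      (I.vars g' 2 = I.vars g 3 ∧ I.vars g' 3 = I.vars g 2)))
    (hC₁X : ∀ v ∈ w₁.1, ∃ j : Fin m, ∃ s : Fin 4, s.val < 2 ∧ I.vars j s = v)
    (hpriv : ∀ j ∈ K ∪ w₁.2.1, ∃ a, Through I a j ∧ ∀ j' ∈ K ∪ w₁.2.1, Through I a j' → j' = j)
    (hidle : P = {e} → w₁.2.1 = ∅ → joinValue y w₁.2.2 P true ≠ 1)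
    (hpart : ∀ g ∈ w₂.2.1, ∀ u v : Fin n, (v = p ∨ v = p') → ((I.vars g 2 = v ∧ I.vars g 3 = u) ∨ (I.vars g 2 = u ∧ I.vars g 3 = v)) →
      ((∀ j ∈ K \ P, Through I u j) ∧ (∀ g' ∈ w₁.2.1, Through I u g') ∧ joinValue y w₁.2.2 (K \ P) true = 1) ∨
      ∃ Z : Finset (Fin n), v ∈ Z ∧ (∀ w ∈ Z, ∃ j : Fin m, Through I w j) ∧
        (∀ j ∈ K ∪ w₁.2.1, (I.vars j 2 = u → I.vars j 3 ∈ Z) ∧ (I.vars j 3 = u → I.vars j 2 ∈ Z)) ∧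
        ((∀ j ∈ K, Dead I Z j) → joinValue y w₁.2.2 K false ≠ 1) ∧
        ((∀ j ∈ P, Dead I Z j) → (∀ g' ∈ w₁.2.1, Dead I Z g') → joinValue y w₁.2.2 P true ≠ 1) ∧
        ((∀ j ∈ K \ P, Dead I Z j) → (∀ g' ∈ w₁.2.1, Dead I Z g') → joinValue y w₁.2.2 (K \ P) true ≠ 1))
    (hT3 : ¬ SatPair I y K w₁ w₂) (hM0 : SatPair I y (K.erase e) w₁ w₂) : False := by
  have he : e ∈ K := hP heP
  have hep : Through I p e := Or.inl hslots.1
  -- AND variables are off `C₁` and off the XOR slots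
  have hC₁ : ∀ v ∈ w₁.1, ∀ j ∈ K ∪ w₁.2.1, ¬ Through I v j := fun v hv j _ hth => through_not_mem hT hC₁X hth hv
  have hpC₁ : p ∉ w₁.1 ∧ p' ∉ w₁.1 := ⟨through_not_mem hT hC₁X hep, through_not_mem hT hC₁X (Or.inr hslots.2 : Through I p' e)⟩
  -- only `e` passes through `p`
  have hponly : ∀ j ∈ K, Through I p j → j = e := by
    intro j hj hth
    by_contra hje
    rcases hth with h | h
    · exact (hpK j hj hje).1 (h ▸ vars_mem_varSet I j 2)
    · exact (hpK j hj hje).1 (h ▸ vars_mem_varSet I j 3)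
  have hpfold : ∀ g ∈ w₁.2.1, ¬ Through I p g := fun g hg hth => by
    rcases hth with h | h
    · exact (hpG₁ g hg).1.1 h
    · exact (hpG₁ g hg).1.2 h
  -- the idle pattern `{p}`: the four candidates
  have hidle' : ∀ D ⊆ K, ∀ t : Bool, IsJoin I w₁.1 D t → (∀ j ∈ D, Through I p j) → (t = true → ∀ g ∈ w₁.2.1, Through I p g) →
      joinValue y w₁.2.2 D t ≠ 1 := by
    have key := forall_join_of_four I hmin hP hPJ
      (fun D t => IsJoin I w₁.1 D t → (∀ j ∈ D, Through I p j) → (t = true → ∀ g ∈ w₁.2.1, Through I p g) →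
        joinValue y w₁.2.2 D t ≠ 1) ?_ ?_ ?_ ?_
    · exact fun D hD t hJ => key D hD t hJ hJ
    · intro _ _ _; rw [joinValue_empty]; exact zero_ne_one
    · intro _ hall _
      exfalso
      have hKe : K = {e} := eq_singleton_iff_unique_mem.2 ⟨he, fun j hj => hponly j hj (hall j hj)⟩
      exact not_even_singleton hI e (hKe ▸ hKev)
    · intro _ hall hfolds
      have hPe : P = {e} := eq_singleton_iff_unique_mem.2 ⟨heP, fun j hj => hponly j (hP hj) (hall j hj)⟩
      have hG : w₁.2.1 = ∅ := eq_empty_of_forall_notMem fun g hg => hpfold g hg (hfolds rfl g hg)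
      exact hidle hPe hG
    · intro hJ hall hfolds
      have hKP : K \ P = ∅ := eq_empty_of_forall_notMem fun j hj => by
        have hje := hponly j (mem_sdiff.1 hj).1 (hall j hj)
        exact (mem_sdiff.1 hj).2 (hje ▸ heP)
      rw [hKP] at hJ ⊢
      have hC : w₁.1 = ∅ := linear_eq_empty_of_isJoin_empty hJ
      have hG : w₁.2.1 = ∅ := eq_empty_of_forall_notMem fun g hg => hpfold g hg (hfolds rfl g hg)
      obtain ⟨q, -, hq₁, -⟩ := hM0
      have hb : w₁.2.2 = false := target_false_of_empty_reader hC hG hq₁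
      simp [joinValue, hb, bit]
  -- the partners: pinned on the other arc, or thawed by a feasible pattern
  have hpart' : ∀ g ∈ w₂.2.1, ∀ u v : Fin n, (v = p ∨ v = p') →
      ((I.vars g 2 = v ∧ I.vars g 3 = u) ∨ (I.vars g 2 = u ∧ I.vars g 3 = v)) →
      (∃ D ⊆ K.erase e, ∃ t : Bool, IsJoin I w₁.1 D t ∧ (∀ j ∈ D, Through I u j) ∧ (t = true → ∀ g' ∈ w₁.2.1, Through I u g') ∧
          joinValue y w₁.2.2 D t = 1) ∨
      (u ∉ w₁.1 ∧ (∀ j ∈ K, I.vars j 0 ≠ u ∧ I.vars j 1 ≠ u) ∧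
        ∃ Z : Finset (Fin n), v ∈ Z ∧ (∀ j ∈ K ∪ w₁.2.1, (I.vars j 2 = u → I.vars j 3 ∈ Z) ∧ (I.vars j 3 = u → I.vars j 2 ∈ Z)) ∧
          (∀ w ∈ Z, ∀ j ∈ K, I.vars j 0 ≠ w ∧ I.vars j 1 ≠ w) ∧ (∀ w ∈ Z, w ∉ w₁.1) ∧
          ∀ D ⊆ K, ∀ t : Bool, IsJoin I w₁.1 D t → (∀ j ∈ D, Dead I Z j) → (t = true → ∀ g' ∈ w₁.2.1, Dead I Z g') →
            joinValue y w₁.2.2 D t ≠ 1) := by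
    intro g hg u v hv hgs
    have hug : Through I u g := by
      rcases hgs with ⟨_, h3⟩ | ⟨h2, _⟩
      · exact Or.inr h3
      · exact Or.inl h2
    rcases hpart g hg u v hv hgs with ⟨hth, hfolds, hval⟩ | ⟨Z, hvZ, hZand, huZ, ha, hb, hc⟩
    · refine Or.inl ⟨K \ P, fun j hj => mem_erase.2 ⟨fun hje => (mem_sdiff.1 hj).2 (hje ▸ heP), (mem_sdiff.1 hj).1⟩, true,
        isJoin_sdiff I hKev hP hPJ, hth, fun _ => hfolds, hval⟩
    · refine Or.inr ⟨through_not_mem hT hC₁X hug, fun j _ => through_ne_xor hT hug j, Z, hvZ, huZ,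
        fun w hw j _ => ?_, fun w hw => ?_, ?_⟩
      · obtain ⟨j', hj'⟩ := hZand w hw; exact through_ne_xor hT hj' j
      · obtain ⟨j', hj'⟩ := hZand w hw; exact through_not_mem hT hC₁X hj'
      · refine forall_join_of_four I hmin hP hPJ
          (fun D t => (∀ j ∈ D, Dead I Z j) → (t = true → ∀ g' ∈ w₁.2.1, Dead I Z g') → joinValue y w₁.2.2 D t ≠ 1) ?_ ?_ ?_ ?_
        · intro _ _; rw [joinValue_empty]; exact zero_ne_one
        · exact fun hall _ => ha hall
        · exact fun hall hfolds => hb hall (hfolds rfl)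
        · exact fun hall hfolds => hc hall (hfolds rfl)
  exact false_of_dirty_member_joins hI hT he hKG hslots hpe hpK hpC₁ hpG₁ hpp' hSG hC₁ hpriv hidle' hpart' hT3 hM0

/-- **The dirty-member check-list kills a terminal core.** -/
theorem not_terminal_of_dirty_member_cycle {r : ℕ} (hI : I.IsPure xorAndPred) (hT : Typed I)
    (hKev : ∀ w, Even (xpdeg I K w)) (hmin : ∀ D ⊆ K, (∀ w, Even (xpdeg I D w)) → D = ∅ ∨ D = K)
    (hP : P ⊆ K) (hPJ : IsJoin I w₁.1 P true) (heP : e ∈ P)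
    (hslots : I.vars e 2 = p ∧ I.vars e 3 = p') (hpe : I.vars e 0 ≠ p ∧ I.vars e 1 ≠ p ∧ I.vars e 0 ≠ p' ∧ I.vars e 1 ≠ p')
    (hpK : ∀ j ∈ K, j ≠ e → p ∉ varSet I j ∧ p' ∉ varSet I j)
    (hpG₁ : ∀ g ∈ w₁.2.1, (I.vars g 2 ≠ p ∧ I.vars g 3 ≠ p) ∧ (I.vars g 2 ≠ p' ∧ I.vars g 3 ≠ p'))
    (hpp' : ∀ g ∈ w₂.2.1, ¬ ((I.vars g 2 = p ∧ I.vars g 3 = p') ∨ (I.vars g 2 = p' ∧ I.vars g 3 = p)))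
    (hSG : ∀ g ∈ w₂.2.1, ∀ g' ∈ w₂.2.1, g' ≠ g → ¬ ((I.vars g' 2 = I.vars g 2 ∧ I.vars g' 3 = I.vars g 3) ∨
      (I.vars g' 2 = I.vars g 3 ∧ I.vars g' 3 = I.vars g 2)))
    (hC₁X : ∀ v ∈ w₁.1, ∃ j : Fin m, ∃ s : Fin 4, s.val < 2 ∧ I.vars j s = v)
    (hpriv : ∀ j ∈ K ∪ w₁.2.1, ∃ a, Through I a j ∧ ∀ j' ∈ K ∪ w₁.2.1, Through I a j' → j' = j)
    (hidle : P = {e} → w₁.2.1 = ∅ → joinValue y w₁.2.2 P true ≠ 1)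
    (hpart : ∀ g ∈ w₂.2.1, ∀ u v : Fin n, (v = p ∨ v = p') → ((I.vars g 2 = v ∧ I.vars g 3 = u) ∨ (I.vars g 2 = u ∧ I.vars g 3 = v)) →
      ((∀ j ∈ K \ P, Through I u j) ∧ (∀ g' ∈ w₁.2.1, Through I u g') ∧ joinValue y w₁.2.2 (K \ P) true = 1) ∨
      ∃ Z : Finset (Fin n), v ∈ Z ∧ (∀ w ∈ Z, ∃ j : Fin m, Through I w j) ∧
        (∀ j ∈ K ∪ w₁.2.1, (I.vars j 2 = u → I.vars j 3 ∈ Z) ∧ (I.vars j 3 = u → I.vars j 2 ∈ Z)) ∧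
        ((∀ j ∈ K, Dead I Z j) → joinValue y w₁.2.2 K false ≠ 1) ∧
        ((∀ j ∈ P, Dead I Z j) → (∀ g' ∈ w₁.2.1, Dead I Z g') → joinValue y w₁.2.2 P true ≠ 1) ∧
        ((∀ j ∈ K \ P, Dead I Z j) → (∀ g' ∈ w₁.2.1, Dead I Z g') → joinValue y w₁.2.2 (K \ P) true ≠ 1)) :
    ¬ Terminal I r y K w₁ w₂ := fun ht =>
  false_of_dirty_member_cycle hI hT ht.2.2.2.1 hKev hmin hP hPJ heP hslots hpe hpK hpG₁ hpp' hSG hC₁X hpriv hidle hpart ht.2.2.2.2.2.2.1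
    (ht.2.2.2.2.2.2.2 e (hP heP))

/-- **The dirty-member check-list kills a minimal core (`TerminalNC`).** -/
theorem not_terminalNC_of_dirty_member_cycle {r : ℕ} (hI : I.IsPure xorAndPred) (hT : Typed I)
    (hKev : ∀ w, Even (xpdeg I K w)) (hmin : ∀ D ⊆ K, (∀ w, Even (xpdeg I D w)) → D = ∅ ∨ D = K)
    (hP : P ⊆ K) (hPJ : IsJoin I w₁.1 P true) (heP : e ∈ P)
    (hslots : I.vars e 2 = p ∧ I.vars e 3 = p') (hpe : I.vars e 0 ≠ p ∧ I.vars e 1 ≠ p ∧ I.vars e 0 ≠ p' ∧ I.vars e 1 ≠ p')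
    (hpK : ∀ j ∈ K, j ≠ e → p ∉ varSet I j ∧ p' ∉ varSet I j)
    (hpG₁ : ∀ g ∈ w₁.2.1, (I.vars g 2 ≠ p ∧ I.vars g 3 ≠ p) ∧ (I.vars g 2 ≠ p' ∧ I.vars g 3 ≠ p'))
    (hpp' : ∀ g ∈ w₂.2.1, ¬ ((I.vars g 2 = p ∧ I.vars g 3 = p') ∨ (I.vars g 2 = p' ∧ I.vars g 3 = p)))
    (hSG : ∀ g ∈ w₂.2.1, ∀ g' ∈ w₂.2.1, g' ≠ g → ¬ ((I.vars g' 2 = I.vars g 2 ∧ I.vars g' 3 = I.vars g 3) ∨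
      (I.vars g' 2 = I.vars g 3 ∧ I.vars g' 3 = I.vars g 2)))
    (hC₁X : ∀ v ∈ w₁.1, ∃ j : Fin m, ∃ s : Fin 4, s.val < 2 ∧ I.vars j s = v)
    (hpriv : ∀ j ∈ K ∪ w₁.2.1, ∃ a, Through I a j ∧ ∀ j' ∈ K ∪ w₁.2.1, Through I a j' → j' = j)
    (hidle : P = {e} → w₁.2.1 = ∅ → joinValue y w₁.2.2 P true ≠ 1)
    (hpart : ∀ g ∈ w₂.2.1, ∀ u v : Fin n, (v = p ∨ v = p') → ((I.vars g 2 = v ∧ I.vars g 3 = u) ∨ (I.vars g 2 = u ∧ I.vars g 3 = v)) →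
      ((∀ j ∈ K \ P, Through I u j) ∧ (∀ g' ∈ w₁.2.1, Through I u g') ∧ joinValue y w₁.2.2 (K \ P) true = 1) ∨
      ∃ Z : Finset (Fin n), v ∈ Z ∧ (∀ w ∈ Z, ∃ j : Fin m, Through I w j) ∧
        (∀ j ∈ K ∪ w₁.2.1, (I.vars j 2 = u → I.vars j 3 ∈ Z) ∧ (I.vars j 3 = u → I.vars j 2 ∈ Z)) ∧
        ((∀ j ∈ K, Dead I Z j) → joinValue y w₁.2.2 K false ≠ 1) ∧
        ((∀ j ∈ P, Dead I Z j) → (∀ g' ∈ w₁.2.1, Dead I Z g') → joinValue y w₁.2.2 P true ≠ 1) ∧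
        ((∀ j ∈ K \ P, Dead I Z j) → (∀ g' ∈ w₁.2.1, Dead I Z g') → joinValue y w₁.2.2 (K \ P) true ≠ 1)) :
    ¬ TerminalNC I r y K w₁ w₂ := fun ht =>
  false_of_dirty_member_cycle hI hT ht.2.2.1 hKev hmin hP hPJ heP hslots hpe hpK hpG₁ hpp' hSG hC₁X hpriv hidle hpart ht.2.2.2.2.2.1
    (ht.2.2.2.2.2.2 e (hP heP))

/-- **THE POSITIVE SHAPE AT A DIRTY MEMBER.**  On a cycle core a certificate ((T3) and (M0) at `e`) needs a `Γ₂`-gate linking the private pair of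
`e` to a variable `u` that is NOT pinned on the other arc and whose every admissible thaw pattern swallows, with value `1`, the whole core or one of
the two arcs-with-folds (contrapositive of `false_of_dirty_member_cycle`; memo g27 §75 (i)). -/
theorem exists_gate_of_dirty_member_cycle (hI : I.IsPure xorAndPred) (hT : Typed I) (hKG : Disjoint K w₁.2.1)
    (hKev : ∀ w, Even (xpdeg I K w)) (hmin : ∀ D ⊆ K, (∀ w, Even (xpdeg I D w)) → D = ∅ ∨ D = K)
    (hP : P ⊆ K) (hPJ : IsJoin I w₁.1 P true) (heP : e ∈ P)
    (hslots : I.vars e 2 = p ∧ I.vars e 3 = p') (hpe : I.vars e 0 ≠ p ∧ I.vars e 1 ≠ p ∧ I.vars e 0 ≠ p' ∧ I.vars e 1 ≠ p')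
    (hpK : ∀ j ∈ K, j ≠ e → p ∉ varSet I j ∧ p' ∉ varSet I j)
    (hpG₁ : ∀ g ∈ w₁.2.1, (I.vars g 2 ≠ p ∧ I.vars g 3 ≠ p) ∧ (I.vars g 2 ≠ p' ∧ I.vars g 3 ≠ p'))
    (hpp' : ∀ g ∈ w₂.2.1, ¬ ((I.vars g 2 = p ∧ I.vars g 3 = p') ∨ (I.vars g 2 = p' ∧ I.vars g 3 = p)))
    (hSG : ∀ g ∈ w₂.2.1, ∀ g' ∈ w₂.2.1, g' ≠ g → ¬ ((I.vars g' 2 = I.vars g 2 ∧ I.vars g' 3 = I.vars g 3) ∨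
      (I.vars g' 2 = I.vars g 3 ∧ I.vars g' 3 = I.vars g 2)))
    (hC₁X : ∀ v ∈ w₁.1, ∃ j : Fin m, ∃ s : Fin 4, s.val < 2 ∧ I.vars j s = v)
    (hpriv : ∀ j ∈ K ∪ w₁.2.1, ∃ a, Through I a j ∧ ∀ j' ∈ K ∪ w₁.2.1, Through I a j' → j' = j)
    (hidle : P = {e} → w₁.2.1 = ∅ → joinValue y w₁.2.2 P true ≠ 1)
    (hT3 : ¬ SatPair I y K w₁ w₂) (hM0 : SatPair I y (K.erase e) w₁ w₂) :
    ∃ g ∈ w₂.2.1, ∃ u v : Fin n, (v = p ∨ v = p') ∧ ((I.vars g 2 = v ∧ I.vars g 3 = u) ∨ (I.vars g 2 = u ∧ I.vars g 3 = v)) ∧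
      ¬ ((∀ j ∈ K \ P, Through I u j) ∧ (∀ g' ∈ w₁.2.1, Through I u g') ∧ joinValue y w₁.2.2 (K \ P) true = 1) ∧
      ∀ Z : Finset (Fin n), v ∈ Z → (∀ w ∈ Z, ∃ j : Fin m, Through I w j) →
        (∀ j ∈ K ∪ w₁.2.1, (I.vars j 2 = u → I.vars j 3 ∈ Z) ∧ (I.vars j 3 = u → I.vars j 2 ∈ Z)) →
        ((∀ j ∈ K, Dead I Z j) ∧ joinValue y w₁.2.2 K false = 1) ∨
        ((∀ j ∈ P, Dead I Z j) ∧ (∀ g' ∈ w₁.2.1, Dead I Z g') ∧ joinValue y w₁.2.2 P true = 1) ∨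
        ((∀ j ∈ K \ P, Dead I Z j) ∧ (∀ g' ∈ w₁.2.1, Dead I Z g') ∧ joinValue y w₁.2.2 (K \ P) true = 1) := by
  by_contra h
  refine false_of_dirty_member_cycle hI hT hKG hKev hmin hP hPJ heP hslots hpe hpK hpG₁ hpp' hSG hC₁X hpriv hidle
    (fun g hg u v hv hgs => ?_) hT3 hM0
  by_contra h'
  rw [not_or] at h'
  refine h ⟨g, hg, u, v, hv, hgs, h'.1, fun Z hvZ hZand huZ => ?_⟩
  by_contra h''
  exact h'.2 ⟨Z, hvZ, hZand, huZ, fun hall hval => h'' (Or.inl ⟨hall, hval⟩),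
    fun hall hfolds hval => h'' (Or.inr (Or.inl ⟨hall, hfolds, hval⟩)),
    fun hall hfolds hval => h'' (Or.inr (Or.inr ⟨hall, hfolds, hval⟩))⟩

/-- **THE ARC OF A DIRTY MEMBER ADMITS NO SECOND READER** («three-block arcs certify nothing», for every `Γ₂`, all `k`).  As in
`false_of_dirty_member_cycle`, but with the partner condition required of EVERY variable `u ∉ {p, p'}` and the thaw pattern fixed to
`{v} ∪ partners(u)`: call `j` LIVE for `(u, v)` if `j` does not pass through `v` and no AND variable of `j` is a `K ∪ G₁`-partner of `u`.  If every
`u` is pinned on the other arc or leaves `K`, `P ∪ G₁` and `(K ∖ P) ∪ G₁` each with a live member or value `0`, then NO second reader `Γ₂` (simple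
overlaps, no gate `{p, p'}`) makes (T3) + (M0)-at-`e` hold. -/
theorem no_reader_of_dirty_member_cycle (hI : I.IsPure xorAndPred) (hT : Typed I) (hKG : Disjoint K w₁.2.1)
    (hKev : ∀ w, Even (xpdeg I K w)) (hmin : ∀ D ⊆ K, (∀ w, Even (xpdeg I D w)) → D = ∅ ∨ D = K)
    (hP : P ⊆ K) (hPJ : IsJoin I w₁.1 P true) (heP : e ∈ P)
    (hslots : I.vars e 2 = p ∧ I.vars e 3 = p') (hpe : I.vars e 0 ≠ p ∧ I.vars e 1 ≠ p ∧ I.vars e 0 ≠ p' ∧ I.vars e 1 ≠ p')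
    (hpK : ∀ j ∈ K, j ≠ e → p ∉ varSet I j ∧ p' ∉ varSet I j)
    (hpG₁ : ∀ g ∈ w₁.2.1, (I.vars g 2 ≠ p ∧ I.vars g 3 ≠ p) ∧ (I.vars g 2 ≠ p' ∧ I.vars g 3 ≠ p'))
    (hC₁X : ∀ v ∈ w₁.1, ∃ j : Fin m, ∃ s : Fin 4, s.val < 2 ∧ I.vars j s = v)
    (hpriv : ∀ j ∈ K ∪ w₁.2.1, ∃ a, Through I a j ∧ ∀ j' ∈ K ∪ w₁.2.1, Through I a j' → j' = j)
    (hidle : P = {e} → w₁.2.1 = ∅ → joinValue y w₁.2.2 P true ≠ 1)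
    (hall : ∀ u v : Fin n, (v = p ∨ v = p') → u ≠ p → u ≠ p' →
      ((∀ j ∈ K \ P, Through I u j) ∧ (∀ g' ∈ w₁.2.1, Through I u g') ∧ joinValue y w₁.2.2 (K \ P) true = 1) ∨
      (((∀ j ∈ K, ¬ (¬ Through I v j ∧ ∀ w, Through I w j → ∀ j' ∈ K ∪ w₁.2.1,
            ¬ ((I.vars j' 2 = u ∧ I.vars j' 3 = w) ∨ (I.vars j' 2 = w ∧ I.vars j' 3 = u)))) → joinValue y w₁.2.2 K false ≠ 1) ∧
        ((∀ j ∈ P ∪ w₁.2.1, ¬ (¬ Through I v j ∧ ∀ w, Through I w j → ∀ j' ∈ K ∪ w₁.2.1,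
            ¬ ((I.vars j' 2 = u ∧ I.vars j' 3 = w) ∨ (I.vars j' 2 = w ∧ I.vars j' 3 = u)))) → joinValue y w₁.2.2 P true ≠ 1) ∧
        ((∀ j ∈ (K \ P) ∪ w₁.2.1, ¬ (¬ Through I v j ∧ ∀ w, Through I w j → ∀ j' ∈ K ∪ w₁.2.1,
            ¬ ((I.vars j' 2 = u ∧ I.vars j' 3 = w) ∨ (I.vars j' 2 = w ∧ I.vars j' 3 = u)))) → joinValue y w₁.2.2 (K \ P) true ≠ 1)))
    (hpp' : ∀ g ∈ w₂.2.1, ¬ ((I.vars g 2 = p ∧ I.vars g 3 = p') ∨ (I.vars g 2 = p' ∧ I.vars g 3 = p)))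
    (hSG : ∀ g ∈ w₂.2.1, ∀ g' ∈ w₂.2.1, g' ≠ g → ¬ ((I.vars g' 2 = I.vars g 2 ∧ I.vars g' 3 = I.vars g 3) ∨
      (I.vars g' 2 = I.vars g 3 ∧ I.vars g' 3 = I.vars g 2)))
    (hT3 : ¬ SatPair I y K w₁ w₂) (hM0 : SatPair I y (K.erase e) w₁ w₂) : False := by
  classical
  refine false_of_dirty_member_cycle hI hT hKG hKev hmin hP hPJ heP hslots hpe hpK hpG₁ hpp' hSG hC₁X hpriv hidle
    (fun g hg u v hv hgs => ?_) hT3 hM0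
  have hne23 : I.vars g 2 ≠ I.vars g 3 := fun h => absurd (hI.2 g h) (by decide)
  have hup : u ≠ p := by
    rintro rfl
    rcases hv with rfl | rfl
    · rcases hgs with ⟨h2, h3⟩ | ⟨h2, h3⟩ <;> exact hne23 (h2.trans h3.symm)
    · exact hpp' g hg (hgs.elim Or.inr Or.inl)
  have hup' : u ≠ p' := by
    rintro rfl
    rcases hv with rfl | rfl
    · exact hpp' g hg hgs
    · rcases hgs with ⟨h2, h3⟩ | ⟨h2, h3⟩ <;> exact hne23 (h2.trans h3.symm)
  rcases hall u v hv hup hup' with hpin | ⟨ha, hb, hc⟩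
  · exact Or.inl hpin
  right
  -- the minimal thaw pattern `{v} ∪ partners(u)`
  set N : Finset (Fin n) := ((K ∪ w₁.2.1).filter (fun j => I.vars j 2 = u)).image (fun j => I.vars j 3) ∪
    ((K ∪ w₁.2.1).filter (fun j => I.vars j 3 = u)).image (fun j => I.vars j 2) with hNdef
  have hN : ∀ w, w ∈ N ↔ ∃ j' ∈ K ∪ w₁.2.1, (I.vars j' 2 = u ∧ I.vars j' 3 = w) ∨ (I.vars j' 2 = w ∧ I.vars j' 3 = u) := by
    intro w
    simp only [hNdef, mem_union, mem_image, mem_filter]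
    constructor
    · rintro (⟨j', ⟨hj', h2⟩, h3⟩ | ⟨j', ⟨hj', h3⟩, h2⟩)
      exacts [⟨j', hj', Or.inl ⟨h2, h3⟩⟩, ⟨j', hj', Or.inr ⟨h2, h3⟩⟩]
    · rintro ⟨j', hj', ⟨h2, h3⟩ | ⟨h2, h3⟩⟩
      exacts [Or.inl ⟨j', ⟨hj', h2⟩, h3⟩, Or.inr ⟨j', ⟨hj', h3⟩, h2⟩]
  have hve : Through I v e := by
    rcases hv with rfl | rfl
    exacts [Or.inl hslots.1, Or.inr hslots.2]
  have hdead : ∀ j, Dead I (insert v N) j → ¬ (¬ Through I v j ∧ ∀ w, Through I w j → ∀ j' ∈ K ∪ w₁.2.1,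
      ¬ ((I.vars j' 2 = u ∧ I.vars j' 3 = w) ∨ (I.vars j' 2 = w ∧ I.vars j' 3 = u))) := by
    rintro j ⟨w, hw, hwj⟩ ⟨hvj, hlive⟩
    rcases mem_insert.1 hw with rfl | hwN
    · exact hvj hwj
    · obtain ⟨j', hj', hpair⟩ := (hN w).1 hwN
      exact hlive w hwj j' hj' hpair
  refine ⟨insert v N, mem_insert_self v N, ?_, ?_, ?_, ?_, ?_⟩
  · intro w hw
    rcases mem_insert.1 hw with rfl | hwN
    · exact ⟨e, hve⟩
    · obtain ⟨j', -, hpair⟩ := (hN w).1 hwN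
      rcases hpair with ⟨_, h3⟩ | ⟨h2, _⟩
      · exact ⟨j', Or.inr h3⟩
      · exact ⟨j', Or.inl h2⟩
  · intro j hj
    exact ⟨fun h2 => mem_insert_of_mem ((hN _).2 ⟨j, hj, Or.inl ⟨h2, rfl⟩⟩),
      fun h3 => mem_insert_of_mem ((hN _).2 ⟨j, hj, Or.inr ⟨rfl, h3⟩⟩)⟩
  · exact fun hK => ha fun j hj => hdead j (hK j hj)
  · exact fun hPd hGd => hb fun j hj => by
      rcases mem_union.1 hj with hj | hj
      exacts [hdead j (hPd j hj), hdead j (hGd j hj)]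
  · exact fun hPd hGd => hc fun j hj => by
      rcases mem_union.1 hj with hj | hj
      exacts [hdead j (hPd j hj), hdead j (hGd j hj)]

end Dirty

end Summit.PneNP.PneNP.Theorems.PstarCycleCoreKills
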